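import Summits.MatrixMultiplication.OmegaCensus.STPPProductFamilies
import Summits.MatrixMultiplication.OmegaCensus.STPPPatternMonotonicity

/-!
# ω-census, MIXED block products: `(2,2,2)^k` hosts from the small patterns `(1,2,2)^k` and `(2,1,1)^k`

HONEST FRAMING (pub-omega census; verbatim): lottery ticket; floor = certified bounds/negative ranges.
Census STRUCTURE tool of the STPP track (seat pub-omega-stpp-3, gen 21), not progress on `ω`: a `(2,2,2)^k` family certifies no
matrix-multiplication bound of interest.

The CKSU product of STPP families (tree `IsSTPP.prod`, `exists_isSTPP_prod`) multiplies size patterns coordinatewise.  Products of a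
`(2,2,2)`-family with a tricolored sum-free set (pattern `(1,1,1)`) are in the tree (`STPPTricoloredProduct`); this file records the two
MIXED products that the census's k = 6 ladder analysis (pub-omega HOME `STATUS.md` 2026-08-27, rows NR222 / P-054) uses:

* `isSTPP_pairPointPoint` — the one-triple family `({0, f}, {0}, {0})` (size pattern `(2,1,1)` when `f ≠ 0`) is an STPP family in ANY
  abelian group;  `isSTPP_pointPairPair` — `({0}, {0, b}, {0, c})` (pattern `(1,2,2)`) is an STPP family iff-direction used here:
  whenever `b ≠ 0`, `c ≠ 0`, `b ≠ c` and `b ≠ -c` (the TPP of one triple);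
* `exists_isSTPP_222_of_122` — **if `H` hosts `(1,2,2)^k` then `F × H` hosts `(2,2,2)^k` for every abelian `F` with a non-zero
  element `f`** (product with `({0,f},{0},{0})`);
* `exists_isSTPP_222_of_211` — **if `H` hosts `(2,1,1)^k` and `F` has `b, c` with `b ≠ 0`, `c ≠ 0`, `b ≠ ±c` (e.g. `F = ℤ/4, ℤ/2 × ℤ/2,
  ℤ/5`) then `F × H` hosts `(2,2,2)^k`** (product with `({0},{0,b},{0,c})`).

So the uniform threshold questions for `(2,2,2)^k` on product types reduce to the HALF-SIZE patterns on a factor — e.g. `(2,1,1)⁵ ⊆ ℤ/5 × ℤ/5`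
gives a structured `(2,2,2)⁵ ⊆ (ℤ/5)³` (NR222), and `(1,2,2)⁶ ⊆ ℤ/8 × ℤ/8` gives `(2,2,2)⁶ ⊆ ℤ/2 × ℤ/8 × ℤ/8`.  No threshold claim is made here.

References: H. Cohn, R. Kleinberg, B. Szegedy, C. Umans, *Group-theoretic algorithms for matrix multiplication*, FOCS 2005
(arXiv:math/0511460), Def. 5.1 and the product remark of §7.
-/

namespace Summit.MatrixMultiplication.OmegaCensus

open Literature.Computability.AlgebraicComplexity Finset

section OneTriple

variable {F : Type*} [AddCommGroup F] [DecidableEq F]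

/-- The one-triple family `({0, f}, {0}, {0})` satisfies CKSU Def. 5.1 in any abelian group (its defining word is `s' − s`).
[cite: CohnKleinbergSzegedyUmans2005, Def. 5.1] -/
theorem isSTPP_pairPointPoint (f : F) :
    IsSTPP (fun _ : Fin 1 => ({0, f} : Finset F)) (fun _ => ({0} : Finset F)) (fun _ => ({0} : Finset F)) := by
  intro i j k s _ s' _ t ht t' ht' u hu u' hu' h0
  rw [mem_singleton] at ht ht' hu hu'
  subst ht; subst ht'; subst hu; subst hu'
  refine ⟨Subsingleton.elim _ _, Subsingleton.elim _ _, ?_, rfl, rfl⟩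
  have : s' - s = 0 := by simpa using h0
  exact (sub_eq_zero.mp this).symm

/-- The one-triple family `({0}, {0, b}, {0, c})` satisfies CKSU Def. 5.1 whenever `b ≠ 0`, `c ≠ 0`, `b ≠ c` and `b ≠ -c` (the
triple product property of a single triple made of a point and two pairs). [cite: CohnKleinbergSzegedyUmans2005, Def. 5.1] -/
theorem isSTPP_pointPairPair {b c : F} (hb : b ≠ 0) (hc0 : c ≠ 0) (hbc : b ≠ c) (hbc' : b ≠ -c) :
    IsSTPP (fun _ : Fin 1 => ({0} : Finset F)) (fun _ => ({0, b} : Finset F)) (fun _ => ({0, c} : Finset F)) := by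
  intro i j k s hs s' hs' t ht t' ht' u hu u' hu' h0
  rw [mem_singleton] at hs hs'
  subst hs; subst hs'
  have h1 : (t' - t) + (u' - u) = 0 := by simpa using h0
  refine ⟨Subsingleton.elim _ _, Subsingleton.elim _ _, rfl, ?_⟩
  rw [mem_insert, mem_singleton] at ht ht' hu hu'
  rcases ht with ht | ht <;> rcases ht' with ht' | ht' <;> rcases hu with hu | hu <;> rcases hu' with hu' | hu' <;>
    rw [ht, ht', hu, hu'] at h1 ⊢ <;> simp only [sub_zero, zero_sub, sub_self, add_zero, zero_add] at h1 <;>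
    first
    | exact ⟨rfl, rfl⟩
    | exact absurd h1 hc0
    | exact absurd (neg_eq_zero.mp h1) hc0
    | exact absurd h1 hb
    | exact absurd (neg_eq_zero.mp h1) hb
    | exact absurd (add_eq_zero_iff_eq_neg.mp h1) hbc'
    | exact absurd ((add_eq_zero_iff_eq_neg.mp h1).trans (neg_neg c)) hbc
    | exact absurd (neg_injective (add_eq_zero_iff_eq_neg.mp h1)) hbc
    | exact absurd (neg_eq_iff_eq_neg.mp ((add_eq_zero_iff_eq_neg.mp h1).trans (neg_neg c))) hbc'

end OneTriple

section MixedProducts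

variable {F H : Type*} [AddCommGroup F] [AddCommGroup H] [DecidableEq F] {k : ℕ}

/-- **`(1,2,2)^k ⊆ H` ⇒ `(2,2,2)^k ⊆ F × H`** for every abelian `F` with a non-zero element: the CKSU product with the one-triple
family `({0,f},{0},{0})`, re-indexed from `Fin (1·k)` to `Fin k`. [cite: CohnKleinbergSzegedyUmans2005, Def. 5.1] -/
theorem exists_isSTPP_222_of_122 {f : F} (hf : f ≠ 0)
    (h : ∃ A B C : Fin k → Finset H, IsSTPP A B C ∧ ∀ i, (A i).card = 1 ∧ (B i).card = 2 ∧ (C i).card = 2) :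
    ∃ A B C : Fin k → Finset (F × H), IsSTPP A B C ∧ ∀ i, (A i).card = 2 ∧ (B i).card = 2 ∧ (C i).card = 2 := by
  have h1 : ∃ A B C : Fin 1 → Finset F, IsSTPP A B C ∧
      ∀ i, (A i).card = (fun _ => 2) i ∧ (B i).card = (fun _ => 1) i ∧ (C i).card = (fun _ => 1) i :=
    ⟨_, _, _, isSTPP_pairPointPoint f, fun _ => ⟨card_pair (Ne.symm hf), card_singleton 0, card_singleton 0⟩⟩
  have h' : ∃ A B C : Fin k → Finset H, IsSTPP A B C ∧
      ∀ i, (A i).card = (fun _ => 1) i ∧ (B i).card = (fun _ => 2) i ∧ (C i).card = (fun _ => 2) i := h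
  obtain ⟨A, B, C, hS, hc⟩ := exists_isSTPP_prod h1 h'
  refine ⟨fun i => A (Fin.cast (one_mul k).symm i), fun i => B (Fin.cast (one_mul k).symm i),
    fun i => C (Fin.cast (one_mul k).symm i), isSTPP_subfamily hS _ (Fin.cast_injective _), fun i => ?_⟩
  obtain ⟨e1, e2, e3⟩ := hc (Fin.cast (one_mul k).symm i)
  exact ⟨e1, e2, e3⟩

/-- **`(2,1,1)^k ⊆ H` and a TPP pair `b, c` in `F` (`b ≠ 0`, `c ≠ 0`, `b ≠ ±c`) ⇒ `(2,2,2)^k ⊆ F × H`**: the CKSU product with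
`({0},{0,b},{0,c})`. [cite: CohnKleinbergSzegedyUmans2005, Def. 5.1] -/
theorem exists_isSTPP_222_of_211 {b c : F} (hb : b ≠ 0) (hc0 : c ≠ 0) (hbc : b ≠ c) (hbc' : b ≠ -c)
    (h : ∃ A B C : Fin k → Finset H, IsSTPP A B C ∧ ∀ i, (A i).card = 2 ∧ (B i).card = 1 ∧ (C i).card = 1) :
    ∃ A B C : Fin k → Finset (F × H), IsSTPP A B C ∧ ∀ i, (A i).card = 2 ∧ (B i).card = 2 ∧ (C i).card = 2 := by
  have h1 : ∃ A B C : Fin 1 → Finset F, IsSTPP A B C ∧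
      ∀ i, (A i).card = (fun _ => 1) i ∧ (B i).card = (fun _ => 2) i ∧ (C i).card = (fun _ => 2) i :=
    ⟨_, _, _, isSTPP_pointPairPair hb hc0 hbc hbc', fun _ => ⟨card_singleton 0, card_pair (Ne.symm hb), card_pair (Ne.symm hc0)⟩⟩
  have h' : ∃ A B C : Fin k → Finset H, IsSTPP A B C ∧
      ∀ i, (A i).card = (fun _ => 2) i ∧ (B i).card = (fun _ => 1) i ∧ (C i).card = (fun _ => 1) i := h
  obtain ⟨A, B, C, hS, hc⟩ := exists_isSTPP_prod h1 h'
  refine ⟨fun i => A (Fin.cast (one_mul k).symm i), fun i => B (Fin.cast (one_mul k).symm i),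
    fun i => C (Fin.cast (one_mul k).symm i), isSTPP_subfamily hS _ (Fin.cast_injective _), fun i => ?_⟩
  obtain ⟨e1, e2, e3⟩ := hc (Fin.cast (one_mul k).symm i)
  exact ⟨e1, e2, e3⟩

/-- Example instantiation (the cofactor `ℤ/2`): `(1,2,2)^k ⊆ H ⇒ (2,2,2)^k ⊆ ℤ/2 × H`. [cite: CohnKleinbergSzegedyUmans2005, Def. 5.1] -/
theorem exists_isSTPP_222_zmod2_prod_of_122
    (h : ∃ A B C : Fin k → Finset H, IsSTPP A B C ∧ ∀ i, (A i).card = 1 ∧ (B i).card = 2 ∧ (C i).card = 2) :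
    ∃ A B C : Fin k → Finset (ZMod 2 × H), IsSTPP A B C ∧ ∀ i, (A i).card = 2 ∧ (B i).card = 2 ∧ (C i).card = 2 :=
  exists_isSTPP_222_of_122 (f := (1 : ZMod 2)) (by decide) h

/-- Example instantiation (the cofactor `ℤ/4` with `b = 1`, `c = 2`): `(2,1,1)^k ⊆ H ⇒ (2,2,2)^k ⊆ ℤ/4 × H`.
[cite: CohnKleinbergSzegedyUmans2005, Def. 5.1] -/
theorem exists_isSTPP_222_zmod4_prod_of_211
    (h : ∃ A B C : Fin k → Finset H, IsSTPP A B C ∧ ∀ i, (A i).card = 2 ∧ (B i).card = 1 ∧ (C i).card = 1) :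
    ∃ A B C : Fin k → Finset (ZMod 4 × H), IsSTPP A B C ∧ ∀ i, (A i).card = 2 ∧ (B i).card = 2 ∧ (C i).card = 2 :=
  exists_isSTPP_222_of_211 (b := (1 : ZMod 4)) (c := 2) (by decide) (by decide) (by decide) (by decide) h

end MixedProducts

end Summit.MatrixMultiplication.OmegaCensus
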